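import Literature.Analysis.FluidPDE.ConvexIntegration2DPlaneWavesRemainder
import HarnessLib

/-!
# Convex integration in 2-D: localized plane waves, III (values, near-orthogonality, energy)

Topic `Analysis/FluidPDE`. Support file for the proof of `ConvexIntegrationLemma2DBall`
(Chiodaroli–De Lellis–Kreml 2015, Lemma 3.7 on a ball): the quantitative consequences of
`wave_eventually_close` used by the perturbation step, all "eventually in the frequency `N`":

* `wave_values_eventually`: `wave_N(z) = s D + R`, `|s| ≤ |A|`, `|R| ≤ ρ` (Prop. 4.1 (i));
* `wave_integral_mul_eventually`: `|∫ wave_{N,i} f| ≤ ε` for a fixed `f ∈ C¹_c`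
  (high-frequency near-orthogonality; replaces the weak-* convergence `(v_k, u_k) ⇀ (v̲, u̲)`
  of CDK §4.1);
* `wave_energy_eventually`: `|∫ (wave₀² + wave₁²) - A²/2 ∫ χ²| ≤ ε` (Prop. 4.1 (ii) in `L²`
  form) and `volume_half_ball_le_integral_cutoff_sq`: `∫ χ² ≥ |B(c, r/2)|`.

## References

* E. Chiodaroli, C. De Lellis, O. Kreml, *Global ill-posedness of the isentropic system of gas
  dynamics*, Comm. Pure Appl. Math. 68 (2015) 1157–1190, Prop. 4.1 and its proof (§4.2).
-/

noncomputable section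

open MeasureTheory Set Metric Filter Function
open scoped ContDiff Topology

namespace Literature.Analysis.FluidPDE.ConvexIntegration

namespace WaveData

variable (d : WaveData)

/-- Values of the wave: `wave_N(z) = s D + R` with `|s| ≤ |A|` and `|R| ≤ ρ`, eventually in `N`,
uniformly in `z` (CDK 2015, Prop. 4.1 (i)). [cite: ChiodaroliDeLellisKreml2015, Prop. 4.1 (i)] -/
theorem wave_values_eventually {ρ : ℝ} (hρ : 0 < ρ) :
    ∀ᶠ N : ℝ in atTop, ∀ z, ∃ s : ℝ, |s| ≤ |d.A| ∧ ∀ i, |d.wave N i z - s * d.Dvec i| ≤ ρ := by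
  filter_upwards [d.wave_eventually_close hρ] with N hN z
  refine ⟨d.A * d.cutoff z * osc d.η N 3 z, ?_, fun i => hN i z⟩
  rw [abs_mul, abs_mul]
  calc |d.A| * |d.cutoff z| * |osc d.η N 3 z| ≤ |d.A| * 1 * 1 := by
        gcongr
        · exact d.abs_cutoff_le_one z
        · exact abs_osc_le_one _ _ _ _
    _ = |d.A| := by ring

/-- The velocity components of `D` are bounded by `1`. [folklore] -/
theorem abs_Dvec_le_one_of_lt_two {i : Fin 4} (hi : i.val < 2) : |d.Dvec i| ≤ 1 := by
  have hn := d.hn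
  have h0 : |d.n 0| ≤ 1 := abs_le_one_iff_mul_self_le_one.mpr (by nlinarith)
  have h1 : |d.n 1| ≤ 1 := abs_le_one_iff_mul_self_le_one.mpr (by nlinarith)
  fin_cases i
  · exact h0
  · exact h1
  · simp at hi
  · simp at hi

/-- The velocity components of the main term are bounded by `|A|`. [folklore] -/
theorem abs_waveMain_le (N : ℝ) {i : Fin 4} (hi : i.val < 2) (z : ST) :
    |d.waveMain N i z| ≤ |d.A| := by
  simp only [waveMain, abs_mul]
  calc |d.A| * |d.cutoff z| * |osc d.η N 3 z| * |d.Dvec i| ≤ |d.A| * 1 * 1 * 1 := by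
        gcongr
        · exact d.abs_cutoff_le_one z
        · exact abs_osc_le_one _ _ _ _
        · exact d.abs_Dvec_le_one_of_lt_two hi
    _ = |d.A| := by ring

/-- The wave is continuous. [folklore] -/
theorem continuous_wave (N : ℝ) (i : Fin 4) : Continuous (d.wave N i) := (d.contDiff_wave N i).continuous

/-- The main term is continuous. [folklore] -/
theorem continuous_waveMain (N : ℝ) (i : Fin 4) : Continuous (d.waveMain N i) := by
  unfold waveMain
  exact ((continuous_const.mul d.contDiff_cutoff.continuous).mul
    (contDiff_osc _ _ _).continuous).mul continuous_const

/-- The main term vanishes off the ball. [folklore] -/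
theorem waveMain_eq_zero {N : ℝ} {i : Fin 4} {z : ST} (hz : z ∉ ball d.c d.r) :
    d.waveMain N i z = 0 := by
  have : d.cutoff z = 0 :=
    image_eq_zero_of_notMem_tsupport fun h => hz (d.tsupport_cutoff_subset_ball h)
  simp [waveMain, this]

/-- **Near-orthogonality of the wave to a fixed amplitude** (high frequency):
`∫ wave_N,i · f → 0`, here as: eventually `|∫ wave_N,i f| ≤ ε`, for `f ∈ C¹_c`.
[cite: ChiodaroliDeLellisKreml2015, §4.1 (weak* convergence `(v_k,u_k) ⇀ (v̲,u̲)`)] -/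
theorem wave_integral_mul_eventually {f : ST → ℝ} (hf : ContDiff ℝ 1 f) (hfc : HasCompactSupport f)
    (i : Fin 4) {ε : ℝ} (hε : 0 < ε) :
    ∀ᶠ N : ℝ in atTop, |∫ z, d.wave N i z * f z| ≤ ε := by
  set If : ℝ := ∫ z, |f z|
  have hIf : 0 ≤ If := integral_nonneg fun z => abs_nonneg _
  set ρ : ℝ := ε / 2 / (If + 1)
  have hρ : 0 < ρ := by positivity
  have hχ1 : ContDiff ℝ 1 d.cutoff := d.contDiff_cutoff.of_le one_le_infty
  -- the main term is an oscillatory integral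
  have h2 : Tendsto (fun N : ℝ => d.A * d.Dvec i * ∫ z, (d.cutoff z * f z) * osc d.η N 3 z)
      atTop (𝓝 0) := by
    have := (tendsto_integral_mul_osc (hχ1.mul hf) (d.hasCompactSupport_cutoff.mul_right)
      d.η_ne_zero 3).const_mul (d.A * d.Dvec i)
    simpa using this
  have h3 : ∀ᶠ N : ℝ in atTop, |d.A * d.Dvec i * ∫ z, (d.cutoff z * f z) * osc d.η N 3 z| ≤ ε / 2 := by
    have := h2.eventually (Metric.closedBall_mem_nhds (0 : ℝ) (by linarith : (0 : ℝ) < ε / 2))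
    filter_upwards [this] with N hN
    rw [Real.dist_eq, sub_zero] at hN
    exact hN
  have hfi : Integrable f := hf.continuous.integrable_of_hasCompactSupport hfc
  filter_upwards [d.wave_eventually_close hρ, h3] with N hN1 hN3
  have hsplit : ∀ z, d.wave N i z * f z
      = d.A * d.Dvec i * ((d.cutoff z * f z) * osc d.η N 3 z)
        + (d.wave N i z - d.waveMain N i z) * f z := by
    intro z; simp only [waveMain]; ring
  have hI1 : Integrable (fun z => d.A * d.Dvec i * ((d.cutoff z * f z) * osc d.η N 3 z)) :=
    (((d.contDiff_cutoff.continuous.mul hf.continuous).mul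
      (contDiff_osc _ _ _).continuous).integrable_of_hasCompactSupport
      (hfc.mul_left.mul_right)).const_mul _
  have hI2 : Integrable (fun z => (d.wave N i z - d.waveMain N i z) * f z) :=
    (((d.continuous_wave N i).sub (d.continuous_waveMain N i)).mul
      hf.continuous).integrable_of_hasCompactSupport hfc.mul_left
  simp_rw [hsplit]
  rw [integral_add hI1 hI2, integral_const_mul]
  calc _ ≤ |d.A * d.Dvec i * ∫ z, (d.cutoff z * f z) * osc d.η N 3 z|
        + |∫ z, (d.wave N i z - d.waveMain N i z) * f z| := abs_add_le _ _
    _ ≤ ε / 2 + ρ * If := by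
        refine add_le_add hN3 ?_
        calc _ ≤ ∫ z, |(d.wave N i z - d.waveMain N i z) * f z| := abs_integral_le_integral_abs
          _ ≤ ∫ z, ρ * |f z| := by
              refine integral_mono hI2.abs (hfi.abs.const_mul ρ) fun z => ?_
              simp only
              rw [abs_mul]
              exact mul_le_mul_of_nonneg_right (hN1 i z) (abs_nonneg _)
          _ = ρ * If := integral_const_mul _ _
    _ ≤ ε / 2 + ε / 2 := by
        gcongr
        calc ρ * If = ε / 2 * (If / (If + 1)) := by simp only [ρ]; field_simp
          _ ≤ ε / 2 * 1 := by
              gcongr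
              rw [div_le_one (by linarith)]; linarith
          _ = ε / 2 := mul_one _
    _ = ε := by ring

/-- `sin² = ½ - ½ cos 2·` for the oscillation profiles: `osc₃² = ½ - ½ osc_{2N,0}`.
[folklore] -/
theorem osc_three_sq (η : ST) (N : ℝ) (z : ST) :
    osc η N 3 z ^ 2 = 1 / 2 - osc η (2 * N) 0 z / 2 := by
  simp only [osc]
  push_cast
  rw [show N * phaseL η z + 3 * (Real.pi / 2) = (N * phaseL η z + Real.pi / 2) + Real.pi by ring,
    Real.cos_add_pi, Real.cos_add_pi_div_two, zero_mul, add_zero, neg_neg, Real.sin_sq,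
    show 2 * N * phaseL η z = 2 * (N * phaseL η z) by ring, Real.cos_two_mul]
  ring

/-- **Energy of the wave:** `∫ (v̲₁² + v̲₂²) → A²/2 ∫ χ²`, here as: eventually
`|∫ (wave₀² + wave₁²) - A²/2 ∫χ²| ≤ ε`. [cite: ChiodaroliDeLellisKreml2015, Prop. 4.1 (ii)] -/
theorem wave_energy_eventually {ε : ℝ} (hε : 0 < ε) :
    ∀ᶠ N : ℝ in atTop, |(∫ z, (d.wave N 0 z ^ 2 + d.wave N 1 z ^ 2))
      - d.A ^ 2 / 2 * ∫ z, d.cutoff z ^ 2| ≤ ε := by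
  set V : ℝ := volume.real (ball d.c d.r)
  have hV : 0 ≤ V := measureReal_nonneg
  have hden : 0 < (4 * |d.A| + 2) * V + 1 := by positivity
  set ρ : ℝ := min 1 (ε / 2 / ((4 * |d.A| + 2) * V + 1))
  have hρ : 0 < ρ := lt_min one_pos (by positivity)
  have hρ1 : ρ ≤ 1 := min_le_left _ _
  have hρ2 : (4 * |d.A| + 2) * V * ρ ≤ ε / 2 := by
    calc (4 * |d.A| + 2) * V * ρ ≤ (4 * |d.A| + 2) * V * (ε / 2 / ((4 * |d.A| + 2) * V + 1)) := by
          gcongr; exact min_le_right _ _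
      _ = ε / 2 * ((4 * |d.A| + 2) * V / ((4 * |d.A| + 2) * V + 1)) := by ring
      _ ≤ ε / 2 * 1 := by
          gcongr; rw [div_le_one hden]; linarith
      _ = ε / 2 := mul_one _
  have hχ := d.contDiff_cutoff
  have hχc := d.hasCompactSupport_cutoff
  have hχ1 : ContDiff ℝ 1 (fun z => d.cutoff z ^ 2) := (hχ.pow 2).of_le one_le_infty
  have hχ2c : HasCompactSupport (fun z => d.cutoff z ^ 2) :=
    hχc.comp_left (g := fun t : ℝ => t ^ 2) (by norm_num)
  -- the oscillatory part of the main energy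
  have hO : Tendsto (fun N : ℝ => d.A ^ 2 / 2 * ∫ z, d.cutoff z ^ 2 * osc d.η (2 * N) 0 z)
      atTop (𝓝 0) := by
    have h1 := (tendsto_integral_mul_osc hχ1 hχ2c d.η_ne_zero 0).comp
      (tendsto_id.const_mul_atTop (by norm_num : (0 : ℝ) < 2))
    have h2 := h1.const_mul (d.A ^ 2 / 2)
    simpa [Function.comp_def] using h2
  have hO' : ∀ᶠ N : ℝ in atTop, |d.A ^ 2 / 2 * ∫ z, d.cutoff z ^ 2 * osc d.η (2 * N) 0 z| ≤ ε / 2 := by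
    have := hO.eventually (Metric.closedBall_mem_nhds (0 : ℝ) (by linarith : (0 : ℝ) < ε / 2))
    filter_upwards [this] with N hN
    rw [Real.dist_eq, sub_zero] at hN
    exact hN
  filter_upwards [d.wave_eventually_close hρ, hO'] with N hR hON
  -- notation
  set w0 := d.wave N 0
  set w1 := d.wave N 1
  set m0 := d.waveMain N 0
  set m1 := d.waveMain N 1
  set E : ST → ℝ := fun z => 2 * m0 z * (w0 z - m0 z) + (w0 z - m0 z) ^ 2
    + 2 * m1 z * (w1 z - m1 z) + (w1 z - m1 z) ^ 2
  have hn := d.hn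
  have hpt : ∀ z, w0 z ^ 2 + w1 z ^ 2
      = (d.A ^ 2 / 2 * d.cutoff z ^ 2 - d.A ^ 2 / 2 * (d.cutoff z ^ 2 * osc d.η (2 * N) 0 z))
        + E z := by
    intro z
    have hm : m0 z ^ 2 + m1 z ^ 2 = d.A ^ 2 * d.cutoff z ^ 2 * osc d.η N 3 z ^ 2 := by
      simp only [m0, m1, waveMain, Dvec_zero, Dvec_one]
      linear_combination (d.A * d.cutoff z * osc d.η N 3 z) ^ 2 * hn
    have ho := osc_three_sq d.η N z
    simp only [E]
    linear_combination hm + d.A ^ 2 * d.cutoff z ^ 2 * ho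
  -- integrability
  have hwc : ∀ i, Continuous (d.wave N i) := d.continuous_wave N
  have hmc : ∀ i, Continuous (d.waveMain N i) := d.continuous_waveMain N
  have hEc : Continuous E := by
    simp only [E, w0, w1, m0, m1]
    fun_prop
  have hEz : ∀ z, z ∉ ball d.c d.r → E z = 0 := by
    intro z hz
    simp only [E, w0, w1, m0, m1, d.wave_eq_zero hz, d.waveMain_eq_zero hz]
    ring
  have hEcs : HasCompactSupport E :=
    HasCompactSupport.intro (isCompact_closedBall d.c d.r) fun z hz =>
      hEz z fun h => hz (ball_subset_closedBall h)
  have hEi : Integrable E := hEc.integrable_of_hasCompactSupport hEcs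
  have hI1 : Integrable (fun z => d.A ^ 2 / 2 * d.cutoff z ^ 2) :=
    (hχ1.continuous.integrable_of_hasCompactSupport hχ2c).const_mul _
  have hI2 : Integrable (fun z => d.A ^ 2 / 2 * (d.cutoff z ^ 2 * osc d.η (2 * N) 0 z)) :=
    ((hχ1.continuous.mul (contDiff_osc _ _ _).continuous).integrable_of_hasCompactSupport
      hχ2c.mul_right).const_mul _
  have hsplit : ∫ z, (w0 z ^ 2 + w1 z ^ 2)
      = d.A ^ 2 / 2 * (∫ z, d.cutoff z ^ 2)
        - d.A ^ 2 / 2 * (∫ z, d.cutoff z ^ 2 * osc d.η (2 * N) 0 z) + ∫ z, E z := by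
    have hI12 : Integrable (fun z => d.A ^ 2 / 2 * d.cutoff z ^ 2
        - d.A ^ 2 / 2 * (d.cutoff z ^ 2 * osc d.η (2 * N) 0 z)) := hI1.sub hI2
    rw [integral_congr_ae (Eventually.of_forall hpt), integral_add hI12 hEi,
      integral_sub hI1 hI2, integral_const_mul, integral_const_mul]
  -- the error integral
  have hEb : ∀ z, |E z| ≤ (4 * |d.A| + 2) * ρ := by
    intro z
    have h0 := hR 0 z
    have h1 := hR 1 z
    have hm0 : |m0 z| ≤ |d.A| := d.abs_waveMain_le N (i := 0) (by norm_num) z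
    have hm1 : |m1 z| ≤ |d.A| := d.abs_waveMain_le N (i := 1) (by norm_num) z
    have e1 : |2 * m0 z * (w0 z - m0 z)| ≤ 2 * |d.A| * ρ := by
      rw [abs_mul, abs_mul, abs_two]
      exact mul_le_mul (mul_le_mul_of_nonneg_left hm0 zero_le_two) h0 (abs_nonneg _)
        (by positivity)
    have e2 : |2 * m1 z * (w1 z - m1 z)| ≤ 2 * |d.A| * ρ := by
      rw [abs_mul, abs_mul, abs_two]
      exact mul_le_mul (mul_le_mul_of_nonneg_left hm1 zero_le_two) h1 (abs_nonneg _)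
        (by positivity)
    have e3 : |(w0 z - m0 z) ^ 2| ≤ ρ := by
      rw [abs_pow, sq]
      calc |w0 z - m0 z| * |w0 z - m0 z| ≤ ρ * 1 :=
            mul_le_mul h0 (h0.trans hρ1) (abs_nonneg _) hρ.le
        _ = ρ := mul_one ρ
    have e4 : |(w1 z - m1 z) ^ 2| ≤ ρ := by
      rw [abs_pow, sq]
      calc |w1 z - m1 z| * |w1 z - m1 z| ≤ ρ * 1 :=
            mul_le_mul h1 (h1.trans hρ1) (abs_nonneg _) hρ.le
        _ = ρ := mul_one ρ
    calc |E z| ≤ |2 * m0 z * (w0 z - m0 z) + (w0 z - m0 z) ^ 2 + 2 * m1 z * (w1 z - m1 z)|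
          + |(w1 z - m1 z) ^ 2| := abs_add_le _ _
      _ ≤ |2 * m0 z * (w0 z - m0 z) + (w0 z - m0 z) ^ 2| + |2 * m1 z * (w1 z - m1 z)|
          + |(w1 z - m1 z) ^ 2| := by gcongr; exact abs_add_le _ _
      _ ≤ |2 * m0 z * (w0 z - m0 z)| + |(w0 z - m0 z) ^ 2| + |2 * m1 z * (w1 z - m1 z)|
          + |(w1 z - m1 z) ^ 2| := by gcongr; exact abs_add_le _ _
      _ ≤ 2 * |d.A| * ρ + ρ + 2 * |d.A| * ρ + ρ := by gcongr
      _ = (4 * |d.A| + 2) * ρ := by ring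
  have hEint : |∫ z, E z| ≤ (4 * |d.A| + 2) * ρ * V := by
    rw [← setIntegral_eq_integral_of_forall_compl_eq_zero (s := ball d.c d.r)
      (fun z hz => hEz z hz)]
    have := norm_setIntegral_le_of_norm_le_const (μ := volume) (s := ball d.c d.r) (f := E)
      measure_ball_lt_top (fun z _ => (Real.norm_eq_abs _).le.trans (hEb z))
    simpa [Real.norm_eq_abs] using this
  rw [hsplit]
  calc _ = |-(d.A ^ 2 / 2 * ∫ z, d.cutoff z ^ 2 * osc d.η (2 * N) 0 z) + ∫ z, E z| := by
        congr 1; ring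
    _ ≤ |-(d.A ^ 2 / 2 * ∫ z, d.cutoff z ^ 2 * osc d.η (2 * N) 0 z)| + |∫ z, E z| :=
        abs_add_le _ _
    _ ≤ ε / 2 + (4 * |d.A| + 2) * ρ * V := by rw [abs_neg]; exact add_le_add hON hEint
    _ ≤ ε / 2 + ε / 2 := by gcongr; linarith [hρ2]
    _ = ε := by ring

/-- The cutoff has energy at least the volume of the half ball. [folklore] -/
theorem volume_half_ball_le_integral_cutoff_sq :
    volume.real (ball d.c (d.r / 2)) ≤ ∫ z, d.cutoff z ^ 2 := by
  have hχ := d.contDiff_cutoff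
  have hχc := d.hasCompactSupport_cutoff
  have hχ2c : HasCompactSupport (fun z => d.cutoff z ^ 2) :=
    hχc.comp_left (g := fun t : ℝ => t ^ 2) (by norm_num)
  have hI : Integrable (fun z => d.cutoff z ^ 2) :=
    (hχ.continuous.pow 2).integrable_of_hasCompactSupport hχ2c
  rw [← integral_indicator_one (μ := volume) (measurableSet_ball (x := d.c) (ε := d.r / 2))]
  refine integral_mono ?_ hI fun z => ?_
  · exact (integrable_indicator_iff measurableSet_ball).mpr
      ((integrableOn_const_iff).mpr (Or.inr measure_ball_lt_top))
  · by_cases hz : z ∈ ball d.c (d.r / 2)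
    · rw [indicator_of_mem hz, d.cutoff_eq_one hz]; norm_num
    · rw [indicator_of_notMem hz]; positivity


end WaveData

end Literature.Analysis.FluidPDE.ConvexIntegration
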